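import Mathlib
import HarnessLib.Audit
import Summits.PneNP.PneNP.Theorems.PstarGateCaseT
import Summits.PneNP.PneNP.Theorems.PstarGateUnitBridge

/-!
# One GATED chord with an AFFINE clean member: no other chord in CASE P, constant `R + ℓ` in CASE T (ROUND-25, O2 / E2; prover-1 g18)

FRONTIER range-avoidance ladder, rung F-N3 (`stmt-PneNP-19007`), cell `pnp-ideate` (this seat's `HOME/pnp-ideate-prover-1/g18/E2-PLAN.md` §2);
restricted-model proof complexity — nothing here bears on `P` versus `NP`.

`PstarForcing.not_forced_of_affine`: a rank-four AND-sum is constant on the zero set of an AFFINE function only if that zero set is empty.  For the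
one-gate configuration this settles the affine sub-regimes of both cases:

* `caseP_affine_no_other_chord` — CASE P with `q = q_{(1,0)}` AFFINE (the second constraint has no quadratic part on the core: linear reads, a pin,
  …): every other chord is ON on `Z(q)` (`caseP_forced`), so `Z(q) = ∅` or there is NO other chord; `Z(q) ≠ ∅` as soon as the gate partner is free —
  generalises `PstarGateCasePPin.no_other_chord_of_pin` to any affine `q`;
* `caseT_forced_on_Z` — CASE T: every other chord is ON on the whole zero set of the GLOBAL clean member `q_m + ℓ` (a sub-case of
  `PstarGateCaseT.caseT_forced`'s enlarged set);
* `caseT_affine_const` — CASE T with `q_m` AFFINE and at least one other chord: `q_m + ℓ ≡ 1`, i.e. **the clean member `R + ℓ` is the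
  infeasible constant** — the OR-READER family `w₁ = (x_u ∨ x_p) + c` of all known E2 examples (PIN + GATE `τ ∨ p`, the `k = 5` hits `σ ∨ a₇`);
  the forcing then comes from the coupling region `{ℓ = 1} ∩ Z(u_e)` alone.
-/

set_option linter.dupNamespace false -- `Summit.PneNP.PneNP.…`: summit = sub-problem name (D-0017 single-conjunct layout)

open Finset Module Literature.Computability.Complexity
open Summit.PneNP.PneNP.Theorems.PstarTyped (Typed)
open Summit.PneNP.PneNP.Theorems.PstarSALevel (varSet bdry BoundaryExpanding SimpleOverlap)
open Summit.PneNP.PneNP.Theorems.PstarCubeIdeals (IsAffineFn)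
open Summit.PneNP.PneNP.Theorems.PstarProductRank (qform)
open Summit.PneNP.PneNP.Theorems.PstarForcing (not_forced_of_affine)
open Summit.PneNP.PneNP.Theorems.PstarReadSumset (V2)
open Summit.PneNP.PneNP.Theorems.PstarChordSystem (ChordSystem)
open Summit.PneNP.PneNP.Theorems.PstarChordBridgeTools (privs coef)
open Summit.PneNP.PneNP.Theorems.PstarChordBridge (BridgeData sys Solution Lift)
open Summit.PneNP.PneNP.Theorems.PstarChordBridgeForcing (gam qform_add' rank_four_of_wf)
open Summit.PneNP.PneNP.Theorems.PstarChordBridgeBasis (qDir)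
open Summit.PneNP.PneNP.Theorems.PstarGateUnitBridge (isAffineFn_coord)
open Summit.PneNP.PneNP.Theorems.PstarGateBridge (GateHyp caseP_forced)
open Summit.PneNP.PneNP.Theorems.PstarGateCaseT (caseT_forced)

namespace Summit.PneNP.PneNP.Theorems.PstarGateAffine

variable {n m : ℕ}

/-- Every element of `𝔽₂` is `0` or `1`. -/
private theorem zmod2_cases (t : ZMod 2) : t = 0 ∨ t = 1 := by
  revert t; decide

/-- **CASE P with an affine `q`: no other chord, or `Z(q)` is empty.**  If some `e' ≠ e` is a chord then `q ≡ 1`. -/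
theorem caseP_affine_no_other_chord (I : LocalMap 4 n m) (hI : I.IsPure xorAndPred) (hT : Typed I) (hS : SimpleOverlap I) {r : ℕ}
    (hB : BoundaryExpanding r I) {B : BridgeData n m} (hW : B.WF I) (hJr : B.J₀.card ≤ r) (hL : Lift I B) {e : Fin m} (hG : GateHyp I B e)
    (hT3 : ¬ ∃ z, Solution I B B.J₀ z)
    (hP : ∀ e' ∈ B.N, e' ≠ e → ∀ a, ((sys I B).ρ e' a = 0 ∨ (sys I B).ρ e' a = (1, 0)) ∧ ((sys I B).ρ' e' a = 0 ∨ (sys I B).ρ' e' a = (1, 0)))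
    (hread : ∀ e' ∈ B.N, e' ≠ e → ∀ a, (sys I B).ρ e' a ≠ 0 ∨ (sys I B).ρ' e' a ≠ 0)
    (hq : IsAffineFn (qDir I B (1, 0))) {e' : Fin m} (he' : e' ∈ B.N) (hne : e' ≠ e) : ∀ x, qDir I B (1, 0) x = 1 :=
  not_forced_of_affine hq (qform_add' I (B.D e')) (rank_four_of_wf I hI hS hB hW hJr he')
    (fun _ hx => (caseP_forced I hI hT hW hL hG hT3 hP hread hx).1 e' he' hne)

/-- **CASE P with an affine `q` and a point of `Z(q)`: the gated chord is the only chord.** -/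
theorem caseP_affine_single (I : LocalMap 4 n m) (hI : I.IsPure xorAndPred) (hT : Typed I) (hS : SimpleOverlap I) {r : ℕ}
    (hB : BoundaryExpanding r I) {B : BridgeData n m} (hW : B.WF I) (hJr : B.J₀.card ≤ r) (hL : Lift I B) {e : Fin m} (hG : GateHyp I B e)
    (hT3 : ¬ ∃ z, Solution I B B.J₀ z)
    (hP : ∀ e' ∈ B.N, e' ≠ e → ∀ a, ((sys I B).ρ e' a = 0 ∨ (sys I B).ρ e' a = (1, 0)) ∧ ((sys I B).ρ' e' a = 0 ∨ (sys I B).ρ' e' a = (1, 0)))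
    (hread : ∀ e' ∈ B.N, e' ≠ e → ∀ a, (sys I B).ρ e' a ≠ 0 ∨ (sys I B).ρ' e' a ≠ 0)
    (hq : IsAffineFn (qDir I B (1, 0))) {x₀ : Fin n → ZMod 2} (hx₀ : qDir I B (1, 0) x₀ = 0) : B.N = {e} := by
  refine eq_singleton_iff_unique_mem.2 ⟨hG.1, fun e' he' => ?_⟩
  by_contra hne
  have h := caseP_affine_no_other_chord I hI hT hS hB hW hJr hL hG hT3 hP hread hq he' hne x₀
  rw [hx₀] at h
  exact zero_ne_one h

/-- **CASE T: every other chord is ON on the zero set of the global clean member `q_m + ℓ`.** -/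
theorem caseT_forced_on_Z (I : LocalMap 4 n m) (hI : I.IsPure xorAndPred) (hT : Typed I) {B : BridgeData n m} (hW : B.WF I) (hL : Lift I B)
    {e : Fin m} (hG : GateHyp I B e) (hT3 : ¬ ∃ z, Solution I B B.J₀ z) {mv : V2} (hmvT : mv = (0, 1) ∨ mv = (1, 1))
    (hP : ∀ e' ∈ B.N, e' ≠ e → ∀ a, ((sys I B).ρ e' a = 0 ∨ (sys I B).ρ e' a = mv) ∧ ((sys I B).ρ' e' a = 0 ∨ (sys I B).ρ' e' a = mv))
    (hread : ∀ e' ∈ B.N, e' ≠ e → ∀ a, (sys I B).ρ e' a ≠ 0 ∨ (sys I B).ρ' e' a ≠ 0) {x : Fin n → ZMod 2}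
    (hx : qDir I B mv x + coef I B.C₁ B.G₁ (I.vars e 2) x = 0) :
    ∀ e' ∈ B.N, e' ≠ e → qform (B.D e') (fun j => I.vars j 2) (fun j => I.vars j 3) x = gam B e' + 1 := by
  refine caseT_forced I hI hT hW hL hG hT3 hmvT hP hread ?_
  rcases zmod2_cases ((sys I B).u e x) with hu | hu
  · rcases zmod2_cases (coef I B.C₁ B.G₁ (I.vars e 2) x) with hl | hl
    · right; rw [hu, zero_mul, add_zero]; rw [hl, add_zero] at hx; exact hx
    · exact Or.inl ⟨hu, hl⟩
  · right; rw [hu, one_mul]; exact hx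

/-- **CASE T with an affine `q_m` and another chord: the clean member `q_m + ℓ` is the constant `1`** (`R + ℓ ≡ ¬t₁`: the OR-reader family). -/
theorem caseT_affine_const (I : LocalMap 4 n m) (hI : I.IsPure xorAndPred) (hT : Typed I) (hS : SimpleOverlap I) {r : ℕ}
    (hB : BoundaryExpanding r I) {B : BridgeData n m} (hW : B.WF I) (hJr : B.J₀.card ≤ r) (hL : Lift I B) {e : Fin m} (hG : GateHyp I B e)
    (hT3 : ¬ ∃ z, Solution I B B.J₀ z) {mv : V2} (hmvT : mv = (0, 1) ∨ mv = (1, 1))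
    (hP : ∀ e' ∈ B.N, e' ≠ e → ∀ a, ((sys I B).ρ e' a = 0 ∨ (sys I B).ρ e' a = mv) ∧ ((sys I B).ρ' e' a = 0 ∨ (sys I B).ρ' e' a = mv))
    (hread : ∀ e' ∈ B.N, e' ≠ e → ∀ a, (sys I B).ρ e' a ≠ 0 ∨ (sys I B).ρ' e' a ≠ 0)
    (hq : IsAffineFn (qDir I B mv)) {u : Fin n} {κ₀ : ZMod 2} (hcoef : ∀ x, coef I B.C₁ B.G₁ (I.vars e 2) x = κ₀ + x u)
    {e' : Fin m} (he' : e' ∈ B.N) (hne : e' ≠ e) : ∀ x, qDir I B mv x + coef I B.C₁ B.G₁ (I.vars e 2) x = 1 := by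
  have haff : IsAffineFn (fun x => qDir I B mv x + coef I B.C₁ B.G₁ (I.vars e 2) x) := by
    intro x w
    simp only [hcoef, Pi.add_apply, Pi.zero_apply]
    rw [hq x w]
    have h3 : κ₀ * 3 = κ₀ := by generalize κ₀ = k; revert k; decide
    ring_nf
    rw [h3]
  exact not_forced_of_affine haff (qform_add' I (B.D e')) (rank_four_of_wf I hI hS hB hW hJr he')
    (fun x hx => caseT_forced_on_Z I hI hT hW hL hG hT3 hmvT hP hread hx e' he' hne)

end Summit.PneNP.PneNP.Theorems.PstarGateAffine
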